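import Literature.MathematicalPhysics.QuantumFieldTheory.Balaban1983to89.B9CoRealizesRelAtLetters
import Literature.MathematicalPhysics.QuantumFieldTheory.Balaban1983to89.B9Thm39ReadingCoords

/-!
# `Balaban1983to89.B9CoReadingCoords` — the κ-FOLD REAL-COORDINATE MODEL of a bond-sector letter: the repaired (3.42) co-readings
# `CoRealizesRel … (RelB i) …` of def-Y's reading `kernelFamilyB` HOLD AT EVERY `U`, FOR EVERY LETTER, with NO domination hypothesis

T. Bałaban, *Propagators for lattice gauge theories in a background field*, Commun. Math. Phys. **99** (1985) 389–434
[`Balaban1985BackgroundPropagators`, "B9"]; [4] = T. Bałaban, *Propagators and renormalization transformations for lattice gauge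
theories. II*, Commun. Math. Phys. **96** (1984) 223–250 [`Balaban1984PropagatorsII`].

statement-level skeleton of published theorems with citation tags; proofs where landed; nothing here is a claim about the
Yang–Mills mass gap

THE PRINTED LOCI.  [B9] p. 389: *"U(x, x′) = exp iηA(x, x′), where A is a function defined on bonds, with values in the Lie algebra 𝔤"*;
(3.39) p. 397 *"|A| = max_μ sup_x |A_μ(x)|"*; (3.42) p. 397 *"|(G(U)J)(x)|, |(∇_U G(U)J)(x)|, |(G(U)∇*_U J)(x)|, |(Δ_U G(U)J)(x)| ≦ … for x ∈ Δ(y),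
y ∈ Λ_j, supp J ⊂ Δ(y′)"* (Thm 3.3 p. 399: λ replaced by a 𝔤-valued bond function J); [4] (2.51)–(2.52) p. 232 (block majorants).

WHY THIS FILE (seat n06-d g4 OFFER-1; def-Y g4 «no objection», n06-j g6 «not mine»).  The N06 knit reads the (3.42) entries of a bond-sector letter
`O : BondOpY 𝔸 i` (G(U), 𝔾_D, G₁, 𝔊, …) through def-Y's `Node00.kernelFamilyB` — sups over the unit ball of `𝔸 = M_N(ℂ) ⊃ 𝔤` of block sups of
`‖(O(U)(J ⊗ E))(x)‖` and its covariant differences — and relates them to a REAL MODEL operator `A` on a model lattice by a CO-READING.  n06-l's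
repaired co-reading `B9CoRealizesRel.CoRealizesRel K n U Rel bu bv ev A` (relative to the carrier-block equivalence `RelB i`, `B9CoRealizesRelAtLetters`) is
inhabited at U = 1 (`exists_coRealizesRel_zero_GA_one`) and, at general U, «by domination» (`coRealizesRel_zero_kernelFamilyB`, hypothesis
`‖O(U)(J ⊗ E)(x)‖ ≤ |(A J)(x)|` with A acting on SCALAR bond functions) — a hypothesis no real-scalar linear model meets for a genuine covariant
letter at U ≠ 1 (the 𝔸-directions of `O(U)(J ⊗ E)` do not factor through `J`).  THIS FILE removes the hypothesis by enlarging the model carrier: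
n06-j g5's real coordinates of `𝔸` (`B9Thm39ReadingCoords.coordBound39 ∕ basisBound39 ∕ cR39`, any real basis `b : κ → 𝔸`) made κ-FOLD —
* §1 (generic finite set `S`, direction set `D`): the carrier `S × D × κ × κ` (a point `(x, ν, c, c′)` = «output coordinate c at x, in direction slot
  ν, of the argument lifted along b_{c′}»); `assembleK b ν c′ f : S → 𝔸` (re-assembly of the (ν, ·, c′)-slice of a coordinate vector); `evDiagK J`
  (the scalar argument `J` placed on the diagonal `c = c′`: its (ν, ·, c′)-slice assembles to `J ⊗ b_{c′}`, `assembleK_evDiagK`); ★ `coordOpK b T` — the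
  coordinate model of a direction-indexed family `T ν` of ℝ-linear operators on `S → 𝔸` (slice-wise conjugation; `assembleK_coordOpK`, FUNCTORIAL:
  `coordOpK_comp`), `coordOpK_evDiagK`; the domination lemma ★ `norm_apply_liftY_le`: `‖(T(J ⊗ E))(x)‖ ≤ cR39 b · M` for `‖E‖ ≤ 1` whenever every coordinate
  `|repr_c (T(J ⊗ b_{c′}))(x)| ≤ M` (linearity in E + `abs_repr_le` + `norm_le_basisBound_mul`).
* §2 (at an index `i`, bond sector): the ℝ-linear covariant differences `cdBₗ ∕ cdsBₗ ∕ lapBₗ` (def-Y's `cdB ∕ cdsB ∕ lapB`, bundled), the carrier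
  `XBK κ i := FBondY i × Fin (d+1) × κ × κ`, the evaluation `evBK` (`.inr J ↦ evDiagK J`, `.inl ↦ 0`), the block map `blkBK bI := bI ∘ fst`, and the MODEL LETTERS
  ★ `GcoK b O cfg U₁ := cR39 b • coordOpK b (fun _ => O (cfg U₁))`, `DcoK`, `DscoK`, `LcoK` (coordinate models of ∇_U, ∇*_U, Δ_U); the composites
  `DcoK ∘ GcoK`, `GcoK ∘ DscoK`, `LcoK ∘ GcoK` ARE `cR39 • coordOpK` of the genuine composites (`DcoK_comp_GcoK`, `GcoK_comp_DscoK`, `LcoK_comp_GcoK`).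
* §3 ★★ `coRealizesRel_kernelFamilyB_coords n` (n = 0, 1, 2, 3): for EVERY bond-sector letter `O`, every backgrounds record `B, cfg`, transporters `par`,
  every `U₁`, every real basis `b`, and every block map `bI` carrier-faithful on carrier blocks (n06-l `exists_carrierFaithful`):
  `CoRealizesRel (kernelFamilyB i B cfg O par) n U₁ (RelB i) (blkBK bI) (blkBK bI) (evBK i) (model_n)` with `model₀ = GcoK`, `model₁ = DcoK ∘ GcoK`,
  `model₂ = GcoK ∘ DscoK`, `model₃ = LcoK ∘ GcoK` — exactly the four shapes of the knit's binders `hcoR ∕ hco1R` (n06-l `thm312Printed_of_stepRelH`,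
  `thm313Printed_of_stepRel`; n06-k `…_rel`).  So a knit that PINS the walk letters' `blk ∕ blkY ∕ G ∕ D ∕ Dstar ∕ Lap` and `ev ∕ evY` to these gadgets
  turns every (3.42) co-reading binder into a `have`, and the displayed model-side schemas then speak about Bałaban's genuine operators in real
  coordinates — print's content verbatim, nothing padded.
HONEST SCOPE.  Finite-dimensional linear algebra over def-Y's readings; the site sector (`kernelFamilyS`), the (3.133) H-kernel co-reading and the
(3.47) ∕ L² ∕ Hölder co-readings are NOT treated here (sequels); nothing of [B9] or [4] is asserted; COUNT-NEUTRAL; N06 NOT discharged; one finite 𝕋⁴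
programme at fixed ε — nothing continuum, nothing about the mass gap.  Cell `pub-ymgap` (HUMAN RULING D-0062), Track A node N06 [B9], seat
`pub-ymgap-dag-n06-d` (g4), 2026-08-27.
-/

noncomputable section

namespace Literature.MathematicalPhysics.QuantumFieldTheory.Balaban1983to89.B9CoReadingCoords

open B6SectAOperatorsV1 (BondIdx)
open B6GlobalChartV1 (PV domT blkV1)
open B6Ineq2142KLevelV1 (β)
open B6KLevelCensusIndexV1 (KIdx abs_le_supNormG)
open B9GeoNormsKLevelV1 (geo9K geo9K_supNorm_nonneg)
open B9CoRealizesRel (CoRealizesRel)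
open B9CoRealizesRelAtLetters (RelB)
open B9Thm39ReadingCoords (coordBound39 basisBound39 cR39 cR39_nonneg abs_repr_le)
open Node00 (SiteY FBondY BlkY IBondY CfgY BallY liftY liftY_apply KLoc supInB kernelFamilyB BondOpY BondParY cdB cdsB lapB iSup_ball_le)

variable {d ℓ : ℕ} {hd : 1 ≤ d + 1} {hL : Odd (ℓ + 1) ∧ 1 < ℓ + 1} {b₀ b₁ : ℝ}
variable {𝔸 : Type} [NormedRing 𝔸] [NormedAlgebra ℂ 𝔸]
variable {κ : Type} [Fintype κ] [DecidableEq κ]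

/-! ## §1 The κ-fold coordinate carrier over a finite set, the diagonal evaluation, the coordinate model of an operator family -/

section Coords

variable {S D : Type} (b : Module.Basis κ ℝ 𝔸)

/-- re-assembly of the `(ν, ·, c′)`-slice of a coordinate vector on `S × D × κ × κ` as an `𝔸`-valued function on `S`: `z ↦ Σ_a f(z, ν, a, c′) • b_a`.
[cite: Balaban1985BackgroundPropagators, p.389 («A with values in the Lie algebra 𝔤»), dictionary] -/
def assembleK (ν : D) (c' : κ) (f : S × D × κ × κ → ℝ) : S → 𝔸 := fun z => ∑ a, f (z, ν, a, c') • b a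

omit [DecidableEq κ] in
/-- `assembleK` is additive. [cite: Balaban1985BackgroundPropagators, p.389, dictionary] -/
theorem assembleK_add (ν : D) (c' : κ) (f g : S × D × κ × κ → ℝ) : assembleK b ν c' (f + g) = assembleK b ν c' f + assembleK b ν c' g := by
  funext z
  simp only [assembleK, Pi.add_apply, add_smul, Finset.sum_add_distrib]

omit [DecidableEq κ] in
/-- `assembleK` commutes with real scalars. [cite: Balaban1985BackgroundPropagators, p.389, dictionary] -/
theorem assembleK_smul (ν : D) (c' : κ) (r : ℝ) (f : S × D × κ × κ → ℝ) : assembleK b ν c' (r • f) = r • assembleK b ν c' f := by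
  funext z
  simp only [assembleK, Pi.smul_apply, smul_eq_mul, Finset.smul_sum, smul_smul]

/-- **the diagonal evaluation of a scalar argument**: `evDiagK J (x, ν, a, c′) := J x` if `a = c′`, else `0` — its `(ν, ·, c′)`-slice assembles to `J ⊗ b_{c′}`.
[cite: Balaban1985BackgroundPropagators, (3.39) p.397 + Thm 3.3 p.399 (𝔤-valued bond functions), dictionary] -/
def evDiagK (J : S → ℝ) : S × D × κ × κ → ℝ := fun p => if p.2.2.1 = p.2.2.2 then J p.1 else 0

omit [Fintype κ] in
/-- `|evDiagK J p| ≤ |J p.1|`. [cite: Balaban1985BackgroundPropagators, (3.39) p.397, bookkeeping] -/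
theorem abs_evDiagK_le (J : S → ℝ) (p : S × D × κ × κ) : |evDiagK (κ := κ) J p| ≤ |J p.1| := by
  unfold evDiagK
  split_ifs
  · exact le_rfl
  · rw [abs_zero]; exact abs_nonneg _

omit [Fintype κ] in
/-- `evDiagK J` vanishes wherever `J` does. [cite: Balaban1985BackgroundPropagators, (3.42) p.397 («supp J ⊂ Δ(y′)»), bookkeeping] -/
theorem evDiagK_eq_zero_of {J : S → ℝ} {p : S × D × κ × κ} (h : J p.1 = 0) : evDiagK (κ := κ) J p = 0 := by
  unfold evDiagK
  split_ifs
  · exact h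
  · rfl

/-- ★ the `(ν, ·, c′)`-slice of `evDiagK J` assembles to the product-form lift `J ⊗ b_{c′}`. [cite: Balaban1985BackgroundPropagators, (3.39) p.397, dictionary] -/
theorem assembleK_evDiagK (ν : D) (c' : κ) (J : S → ℝ) : assembleK b ν c' (evDiagK J) = liftY J (b c') := by
  funext z
  simp only [assembleK, evDiagK]
  rw [Finset.sum_eq_single c']
  · simp only [if_true, liftY_apply]
    exact (Complex.coe_smul (J z) (b c')).symm
  · intro a _ ha
    rw [if_neg ha, zero_smul]
  · intro h; exact absurd (Finset.mem_univ _) h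

/-- ★ **THE COORDINATE MODEL OF A DIRECTION-INDEXED FAMILY OF ℝ-LINEAR OPERATORS ON `S → 𝔸`**: `(coordOpK b T f)(x, ν, c, c′) := repr_c ((T ν (assembleK b ν c′ f))(x))`
— slice-wise conjugation by the coordinates of `b`. [cite: Balaban1985BackgroundPropagators, (3.42) p.397 (the operators read); Balaban1984PropagatorsII, (2.51) p.232 (the model), dictionary] -/
def coordOpK (T : D → (S → 𝔸) →ₗ[ℝ] (S → 𝔸)) : (S × D × κ × κ → ℝ) →ₗ[ℝ] (S × D × κ × κ → ℝ) where
  toFun f := fun p => b.repr (T p.2.1 (assembleK b p.2.1 p.2.2.2 f) p.1) p.2.2.1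
  map_add' f g := by
    funext p
    simp only [assembleK_add, map_add, Pi.add_apply, Finsupp.coe_add]
  map_smul' r f := by
    funext p
    simp only [assembleK_smul, map_smul, Pi.smul_apply, Finsupp.coe_smul, RingHom.id_apply, smul_eq_mul]

omit [DecidableEq κ] in
/-- `coordOpK`, evaluated. [cite: Balaban1985BackgroundPropagators, (3.42) p.397, dictionary] -/
theorem coordOpK_apply (T : D → (S → 𝔸) →ₗ[ℝ] (S → 𝔸)) (f : S × D × κ × κ → ℝ) (p : S × D × κ × κ) :
    coordOpK b T f p = b.repr (T p.2.1 (assembleK b p.2.1 p.2.2.2 f) p.1) p.2.2.1 := rfl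

omit [DecidableEq κ] in
/-- re-assembling the coordinates of the image gives the image: `assembleK (coordOpK T f) = T (assembleK f)` slice by slice. [cite: Balaban1985BackgroundPropagators, (3.42) p.397, dictionary] -/
theorem assembleK_coordOpK (T : D → (S → 𝔸) →ₗ[ℝ] (S → 𝔸)) (f : S × D × κ × κ → ℝ) (ν : D) (c' : κ) :
    assembleK b ν c' (coordOpK b T f) = T ν (assembleK b ν c' f) := by
  funext z
  simp only [assembleK, coordOpK_apply]
  exact b.sum_repr _

omit [DecidableEq κ] in
/-- ★ **FUNCTORIALITY**: the coordinate model of a composite is the composite of the coordinate models (slice-wise).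
[cite: Balaban1985BackgroundPropagators, (3.42) p.397 (∇_U G, G∇*_U, Δ_U G as composites), dictionary] -/
theorem coordOpK_comp (T T' : D → (S → 𝔸) →ₗ[ℝ] (S → 𝔸)) : coordOpK b T ∘ₗ coordOpK b T' = coordOpK b (fun ν => T ν ∘ₗ T' ν) := by
  apply LinearMap.ext; intro f; funext p
  simp only [LinearMap.comp_apply, coordOpK_apply, assembleK_coordOpK]

/-- ★ the coordinate model on the diagonal evaluation reads the coordinates of `T(J ⊗ b_{c′})`. [cite: Balaban1985BackgroundPropagators, (3.42) p.397, dictionary] -/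
theorem coordOpK_evDiagK (T : D → (S → 𝔸) →ₗ[ℝ] (S → 𝔸)) (J : S → ℝ) (p : S × D × κ × κ) :
    coordOpK b T (evDiagK J) p = b.repr (T p.2.1 (liftY J (b p.2.2.2)) p.1) p.2.2.1 := by
  rw [coordOpK_apply, assembleK_evDiagK]

omit [DecidableEq κ] in
/-- `‖v‖ ≤ (Σ_c ‖b_c‖) · M` when every coordinate of `v` is `≤ M` in absolute value. [cite: Balaban1985BackgroundPropagators, p.389, dictionary] -/
theorem norm_le_basisBound_mul (v : 𝔸) {M : ℝ} (hM : ∀ c, |b.repr v c| ≤ M) : ‖v‖ ≤ basisBound39 b * M := by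
  have hv : v = ∑ c, b.repr v c • b c := (b.sum_repr v).symm
  calc ‖v‖ = ‖∑ c, b.repr v c • b c‖ := by rw [← hv]
    _ ≤ ∑ c, ‖b.repr v c • b c‖ := norm_sum_le _ _
    _ = ∑ c, |b.repr v c| * ‖b c‖ := by simp [norm_smul]
    _ ≤ ∑ c, M * ‖b c‖ := Finset.sum_le_sum fun c _ => mul_le_mul_of_nonneg_right (hM c) (norm_nonneg _)
    _ = basisBound39 b * M := by rw [← Finset.mul_sum, basisBound39, mul_comm]

omit [DecidableEq κ] in
/-- ★ **DOMINATION OF THE READING BY THE COORDINATES**: for an ℝ-linear `T` on `S → 𝔸`, `‖E‖ ≤ 1` and a common bound `M` of the coordinates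
`|repr_c ((T(J ⊗ b_{c′}))(x))|` over `c, c′`: `‖(T(J ⊗ E))(x)‖ ≤ cR39 b · M` (`cR39 = coordBound · basisBound · |κ|`).
[cite: Balaban1985BackgroundPropagators, (3.39) + (3.42) p.397 (the norm read), dictionary] -/
theorem norm_apply_liftY_le [FiniteDimensional ℝ 𝔸] (T : (S → 𝔸) →ₗ[ℝ] (S → 𝔸)) (J : S → ℝ) {E : 𝔸} (hE : ‖E‖ ≤ 1) (x : S)
    {M : ℝ} (hM : ∀ c c', |b.repr (T (liftY J (b c')) x) c| ≤ M) : ‖T (liftY J E) x‖ ≤ cR39 b * M := by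
  have hdec : liftY (X := S) J E = ∑ c', (b.repr E c') • liftY J (b c') := by
    funext z
    rw [Finset.sum_apply, liftY_apply]
    conv_lhs => rw [← b.sum_repr E]
    rw [Finset.smul_sum]
    refine Finset.sum_congr rfl fun c' _ => ?_
    rw [Pi.smul_apply, liftY_apply, smul_comm]
  have hT : T (liftY J E) x = ∑ c', (b.repr E c') • T (liftY J (b c')) x := by
    rw [hdec, map_sum, Finset.sum_apply]
    refine Finset.sum_congr rfl fun c' _ => ?_
    rw [map_smul, Pi.smul_apply]
  have hcb : 0 ≤ coordBound39 b := norm_nonneg _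
  have hbb : 0 ≤ basisBound39 b := Finset.sum_nonneg fun _ _ => norm_nonneg _
  rw [hT]
  calc ‖∑ c', (b.repr E c') • T (liftY J (b c')) x‖ ≤ ∑ c', ‖(b.repr E c') • T (liftY J (b c')) x‖ := norm_sum_le _ _
    _ = ∑ c', |b.repr E c'| * ‖T (liftY J (b c')) x‖ := by simp [norm_smul]
    _ ≤ ∑ c' : κ, (coordBound39 b * 1) * (basisBound39 b * M) := by
        refine Finset.sum_le_sum fun c' _ => mul_le_mul ?_ (norm_le_basisBound_mul b _ fun c => hM c c') (norm_nonneg _)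
          (mul_nonneg hcb zero_le_one)
        exact (abs_repr_le b E c').trans (mul_le_mul_of_nonneg_left hE hcb)
    _ = cR39 b * M := by
        rw [Finset.sum_const, nsmul_eq_mul, Finset.card_univ, cR39]; ring

end Coords

/-! ## §2 At an index: the ℝ-linear covariant differences, the bond-sector carrier, the model letters -/

section Bond

variable [CompleteSpace 𝔸] (i : KIdx d ℓ hd hL b₀ b₁)

/-- def-Y's `cdB` (∇_{U,ν} on the bond sector, physical units) as an ℝ-linear map. [cite: Balaban1985BackgroundPropagators, (3.3) p.390] -/
def cdBₗ (U : CfgY 𝔸 i) (ν : Fin (d + 1)) : (FBondY i → 𝔸) →ₗ[ℝ] (FBondY i → 𝔸) where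
  toFun := cdB i U ν
  map_add' A A' := by
    funext x
    simp only [cdB, Pi.add_apply]
    rw [← smul_add, ← B9Eq39Adjoint.covD_add]
    rfl
  map_smul' r A := by
    funext x
    simp only [cdB, Pi.smul_apply, RingHom.id_apply]
    have h1 : (fun s => r • A ⟨s, x.dir⟩) = (r : ℂ) • (fun s => A ⟨s, x.dir⟩) := by
      funext s; simp only [Pi.smul_apply, Complex.coe_smul]
    rw [h1, B9Eq39Adjoint.covD_smul, ← Complex.coe_smul r, smul_comm]

/-- def-Y's `cdsB` (∇*_{U,ν} on the bond sector) as an ℝ-linear map. [cite: Balaban1985BackgroundPropagators, (3.8) p.392] -/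
def cdsBₗ (U : CfgY 𝔸 i) (ν : Fin (d + 1)) : (FBondY i → 𝔸) →ₗ[ℝ] (FBondY i → 𝔸) where
  toFun := cdsB i U ν
  map_add' A A' := by
    funext x
    simp only [cdsB, Pi.add_apply]
    rw [← smul_add, ← B9Eq39Adjoint.covDstar_add]
    rfl
  map_smul' r A := by
    funext x
    simp only [cdsB, Pi.smul_apply, RingHom.id_apply]
    have h1 : (fun s => r • A ⟨s, x.dir⟩) = (r : ℂ) • (fun s => A ⟨s, x.dir⟩) := by
      funext s; simp only [Pi.smul_apply, Complex.coe_smul]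
    rw [h1, B9Eq39Adjoint.covDstar_smul, ← Complex.coe_smul r, smul_comm]

/-- def-Y's `lapB` (the covariant Laplacian `Σ_μ ∇*_{U,μ}∇_{U,μ}` on the bond sector) as an ℝ-linear map. [cite: Balaban1985BackgroundPropagators, (3.23) p.395] -/
def lapBₗ (U : CfgY 𝔸 i) : (FBondY i → 𝔸) →ₗ[ℝ] (FBondY i → 𝔸) :=
  ∑ μ : Fin (d + 1), cdsBₗ i U μ ∘ₗ cdBₗ i U μ

/-- `cdBₗ` IS `cdB`. [cite: Balaban1985BackgroundPropagators, (3.3) p.390, bookkeeping] -/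
theorem cdBₗ_apply (U : CfgY 𝔸 i) (ν : Fin (d + 1)) (A : FBondY i → 𝔸) : cdBₗ i U ν A = cdB i U ν A := rfl

/-- `cdsBₗ` IS `cdsB`. [cite: Balaban1985BackgroundPropagators, (3.8) p.392, bookkeeping] -/
theorem cdsBₗ_apply (U : CfgY 𝔸 i) (ν : Fin (d + 1)) (A : FBondY i → 𝔸) : cdsBₗ i U ν A = cdsB i U ν A := rfl

/-- `lapBₗ` IS `lapB`. [cite: Balaban1985BackgroundPropagators, (3.23) p.395, bookkeeping] -/
theorem lapBₗ_apply (U : CfgY 𝔸 i) (A : FBondY i → 𝔸) : lapBₗ i U A = lapB i U A := by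
  funext x
  simp only [lapBₗ, LinearMap.coe_sum, Finset.sum_apply, LinearMap.comp_apply, cdsBₗ_apply, cdBₗ_apply, lapB]

variable (κ) in
/-- **the κ-fold coordinate carrier of the bond sector** at an index: fine bond × direction slot × output coordinate × lift direction.
[cite: Balaban1985BackgroundPropagators, (3.39) + (3.42) p.397, dictionary] -/
abbrev XBK : Type := FBondY i × Fin (d + 1) × κ × κ

/-- the evaluation of the sum-typed arguments of `geo9K i` on the carrier: `.inr J ↦ evDiagK J`, `.inl f ↦ 0` (the bond-sector readings are OFF on site arguments).
[cite: Balaban1985BackgroundPropagators, (3.39) p.397, dictionary] -/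
def evBK : (geo9K i).Loc → XBK κ i → ℝ := fun lam p => match lam with
  | .inr J => evDiagK J p
  | .inl _ => 0

/-- the block map of the carrier through a block map `bI` on fine bonds. [cite: Balaban1984PropagatorsII, (2.45) p.231, dictionary] -/
def blkBK (bI : FBondY i → IBondY i) : XBK κ i → IBondY i := fun p => bI p.1

variable (b : Module.Basis κ ℝ 𝔸) [FiniteDimensional ℝ 𝔸] (B : B9.Backgrounds) (cfg : B.Cfg → CfgY 𝔸 i) (O : BondOpY 𝔸 i)

/-- ★ **THE MODEL LETTER OF `O` AT `U₁`**: `cR39 b • coordOpK b (fun _ => O(cfg U₁))` — the genuine operator in κ-fold real coordinates, scaled by the reading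
constant. [cite: Balaban1985BackgroundPropagators, (3.42) p.397 («G(U)»); Balaban1984PropagatorsII, (2.51) p.232] -/
def GcoK (U₁ : B.Cfg) : (XBK κ i → ℝ) →ₗ[ℝ] (XBK κ i → ℝ) := cR39 b • coordOpK b (fun _ : Fin (d + 1) => (O (cfg U₁)).restrictScalars ℝ)

/-- the model of `∇_U` (all directions, one per direction slot). [cite: Balaban1985BackgroundPropagators, (3.42) p.397 («∇_U G(U)»)] -/
def DcoK (U₁ : B.Cfg) : (XBK κ i → ℝ) →ₗ[ℝ] (XBK κ i → ℝ) := coordOpK b (fun ν => cdBₗ i (cfg U₁) ν)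

/-- the model of `∇*_U`. [cite: Balaban1985BackgroundPropagators, (3.42) p.397 («G(U)∇*_U»)] -/
def DscoK (U₁ : B.Cfg) : (XBK κ i → ℝ) →ₗ[ℝ] (XBK κ i → ℝ) := coordOpK b (fun ν => cdsBₗ i (cfg U₁) ν)

/-- the model of `Δ_U`. [cite: Balaban1985BackgroundPropagators, (3.42) p.397 («Δ_U G(U)»)] -/
def LcoK (U₁ : B.Cfg) : (XBK κ i → ℝ) →ₗ[ℝ] (XBK κ i → ℝ) := coordOpK b (fun _ : Fin (d + 1) => lapBₗ i (cfg U₁))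

omit [DecidableEq κ] in
/-- the entry-1 composite IS the scaled coordinate model of `ν ↦ ∇_{U,ν} ∘ O(U)`. [cite: Balaban1985BackgroundPropagators, (3.42) p.397, bookkeeping] -/
theorem DcoK_comp_GcoK (U₁ : B.Cfg) :
    DcoK i b B cfg U₁ ∘ₗ GcoK i b B cfg O U₁ = cR39 b • coordOpK b (fun ν => cdBₗ i (cfg U₁) ν ∘ₗ (O (cfg U₁)).restrictScalars ℝ) := by
  rw [DcoK, GcoK, LinearMap.comp_smul, coordOpK_comp]

omit [DecidableEq κ] in
/-- the entry-2 composite IS the scaled coordinate model of `ν ↦ O(U) ∘ ∇*_{U,ν}`. [cite: Balaban1985BackgroundPropagators, (3.42) p.397, bookkeeping] -/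
theorem GcoK_comp_DscoK (U₁ : B.Cfg) :
    GcoK i b B cfg O U₁ ∘ₗ DscoK i b B cfg U₁ = cR39 b • coordOpK b (fun ν => (O (cfg U₁)).restrictScalars ℝ ∘ₗ cdsBₗ i (cfg U₁) ν) := by
  rw [DscoK, GcoK, LinearMap.smul_comp, coordOpK_comp]

omit [DecidableEq κ] in
/-- the entry-3 composite IS the scaled coordinate model of `Δ_U ∘ O(U)`. [cite: Balaban1985BackgroundPropagators, (3.42) p.397, bookkeeping] -/
theorem LcoK_comp_GcoK (U₁ : B.Cfg) :
    LcoK i b B cfg U₁ ∘ₗ GcoK i b B cfg O U₁ = cR39 b • coordOpK b (fun _ : Fin (d + 1) => lapBₗ i (cfg U₁) ∘ₗ (O (cfg U₁)).restrictScalars ℝ) := by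
  rw [LcoK, GcoK, LinearMap.comp_smul, coordOpK_comp]

end Bond

/-! ## §3 ★★ The repaired (3.42) co-readings of `kernelFamilyB` HOLD on the coordinate model — every letter, every `U`, no domination hypothesis -/

section CoReading

variable [CompleteSpace 𝔸] [FiniteDimensional ℝ 𝔸] (i : KIdx d ℓ hd hL b₀ b₁) (b : Module.Basis κ ℝ 𝔸)
variable (B : B9.Backgrounds) (cfg : B.Cfg → CfgY 𝔸 i) (O : BondOpY 𝔸 i) (par : BondParY 𝔸 i) (U₁ : B.Cfg)
variable {bI : FBondY i → IBondY i}

omit [Fintype κ] [FiniteDimensional ℝ 𝔸] in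
/-- `off`, `bound`, `norm_nonneg` of the coordinate model — the three model-side fields, for any relation-free data.
[cite: Balaban1985BackgroundPropagators, (3.39) + (3.42) p.397, bookkeeping] -/
theorem off_bound_evBK (hβI : ∀ (x : FBondY i) (c : IBondY i), blkV1 i.hN i.D x = β i.hN i.D i.hk c → β i.hN i.D i.hk (bI x) = blkV1 i.hN i.D x) :
    (∀ (lam : (geo9K i).Loc) (y' : (geo9K i).Site), (geo9K i).suppIn lam y' → ∀ p : XBK κ i, ¬ RelB i (blkBK i bI p) y' → evBK i lam p = 0) ∧
    (∀ (lam : (geo9K i).Loc) (p : XBK κ i), |evBK i lam p| ≤ (geo9K i).supNorm lam) := by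
  refine ⟨?_, ?_⟩
  · intro lam y' hs p hrel
    cases lam with
    | inl f => rfl
    | inr J =>
        refine evDiagK_eq_zero_of ?_
        by_contra hJ
        have hx : blkV1 i.hN i.D p.1 = β i.hN i.D i.hk y' := hs p.1 hJ
        exact hrel ((hβI p.1 y' hx).trans hx)
  · intro lam p
    cases lam with
    | inl f => show |(0 : ℝ)| ≤ _; rw [abs_zero]; exact geo9K_supNorm_nonneg i _
    | inr J => exact (abs_evDiagK_le J p).trans (abs_le_supNormG i J p.1)

/-- ★ **THE CORE OF `obs`**: if the scaled coordinate model of a family `T` is `≤ c` in absolute value on the class of `y` at the diagonal evaluation of `J`,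
then every `‖(T ν (J ⊗ E))(x)‖ ≤ c` for `‖E‖ ≤ 1`, every direction slot `ν` and every fine bond `x` of the carrier block `β y`.
[cite: Balaban1985BackgroundPropagators, (3.39) + (3.42) p.397; Balaban1984PropagatorsII, (2.51) p.232] -/
theorem norm_le_of_coordModel_le (hβI : ∀ (x : FBondY i) (c : IBondY i), blkV1 i.hN i.D x = β i.hN i.D i.hk c → β i.hN i.D i.hk (bI x) = blkV1 i.hN i.D x)
    (T : Fin (d + 1) → (FBondY i → 𝔸) →ₗ[ℝ] (FBondY i → 𝔸)) (J : FBondY i → ℝ) (y : IBondY i) {c : ℝ} (hc : 0 ≤ c)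
    (h : ∀ p : XBK κ i, RelB i (blkBK i bI p) y → |(cR39 b • coordOpK b T) (evDiagK J) p| ≤ c)
    (E : BallY 𝔸) (ν : Fin (d + 1)) (x : FBondY i) (hx : blkV1 i.hN i.D x = β i.hN i.D i.hk y) : ‖T ν (liftY J (E : 𝔸)) x‖ ≤ c := by
  have hE : ‖(E : 𝔸)‖ ≤ 1 := mem_closedBall_zero_iff.1 E.2
  have hrel : ∀ cc cc' : κ, RelB i (blkBK i bI ((x, ν, cc, cc') : XBK κ i)) y := fun cc cc' => (hβI x y hx).trans hx
  -- the coordinates of `T ν (J ⊗ b_{c′}) x`, scaled by `cR39 b`, are ≤ c on the class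
  have hcoord : ∀ cc cc' : κ, cR39 b * |b.repr (T ν (liftY J (b cc')) x) cc| ≤ c := by
    intro cc cc'
    have := h (x, ν, cc, cc') (hrel cc cc')
    rwa [LinearMap.smul_apply, Pi.smul_apply, coordOpK_evDiagK, smul_eq_mul, abs_mul, abs_of_nonneg (cR39_nonneg b)] at this
  rcases isEmpty_or_nonempty κ with hκ | hκ
  · -- no coordinates: `𝔸` is trivial, the value is `0`
    have hA : ∀ v : 𝔸, v = 0 := fun v => by
      rw [← b.sum_repr v]; exact Finset.sum_eq_zero fun c _ => (hκ.false c).elim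
    rw [hA (T ν (liftY J (E : 𝔸)) x), norm_zero]; exact hc
  · -- `M` := the largest coordinate; `cR39 · M ≤ c`
    obtain ⟨q, -, hq⟩ := Finset.exists_max_image (Finset.univ : Finset (κ × κ)) (fun q => |b.repr (T ν (liftY J (b q.2)) x) q.1|)
      Finset.univ_nonempty
    have hM : ∀ cc cc' : κ, |b.repr (T ν (liftY J (b cc')) x) cc| ≤ |b.repr (T ν (liftY J (b q.2)) x) q.1| :=
      fun cc cc' => hq (cc, cc') (Finset.mem_univ _)
    exact (norm_apply_liftY_le b (T ν) J hE x hM).trans (hcoord q.1 q.2)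

/-- the peeling of the reading, CONSTANT family (entries 0 and 3): `sup_{‖E‖≤1} sup_{x ∈ β y} ‖(T(J ⊗ E))(x)‖ ≤ c` from the coordinate bound on the class.
[cite: Balaban1985BackgroundPropagators, (3.39) + (3.42) p.397, bookkeeping] -/
theorem iSup_supInB_le_of_coordModel (hβI : ∀ (x : FBondY i) (c : IBondY i), blkV1 i.hN i.D x = β i.hN i.D i.hk c → β i.hN i.D i.hk (bI x) = blkV1 i.hN i.D x)
    (T : (FBondY i → 𝔸) →ₗ[ℝ] (FBondY i → 𝔸)) (J : FBondY i → ℝ) (y : IBondY i) {c : ℝ} (hc : 0 ≤ c)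
    (h : ∀ p : XBK κ i, RelB i (blkBK i bI p) y → |(cR39 b • coordOpK b (fun _ : Fin (d + 1) => T)) (evDiagK J) p| ≤ c) :
    (⨆ E : BallY 𝔸, supInB i (β i.hN i.D i.hk y) (T (liftY J (E : 𝔸)))) ≤ c := by
  refine iSup_ball_le (fun E => ?_) hc
  unfold supInB
  exact Real.iSup_le (fun x => norm_le_of_coordModel_le i b hβI (fun _ : Fin (d + 1) => T) J y hc h E 0 x.1 x.2) hc

/-- the peeling of the reading, DIRECTION-INDEXED family (entries 1 and 2): `sup_{‖E‖≤1} sup_ν sup_{x ∈ β y} ‖(T ν (J ⊗ E))(x)‖ ≤ c` from the coordinate bound.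
[cite: Balaban1985BackgroundPropagators, (3.39) + (3.42) p.397, bookkeeping] -/
theorem iSup_iSup_supInB_le_of_coordModel
    (hβI : ∀ (x : FBondY i) (c : IBondY i), blkV1 i.hN i.D x = β i.hN i.D i.hk c → β i.hN i.D i.hk (bI x) = blkV1 i.hN i.D x)
    (T : Fin (d + 1) → (FBondY i → 𝔸) →ₗ[ℝ] (FBondY i → 𝔸)) (J : FBondY i → ℝ) (y : IBondY i) {c : ℝ} (hc : 0 ≤ c)
    (h : ∀ p : XBK κ i, RelB i (blkBK i bI p) y → |(cR39 b • coordOpK b T) (evDiagK J) p| ≤ c) :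
    (⨆ E : BallY 𝔸, ⨆ ν : Fin (d + 1), supInB i (β i.hN i.D i.hk y) (T ν (liftY J (E : 𝔸)))) ≤ c := by
  refine iSup_ball_le (fun E => Real.iSup_le (fun ν => ?_) hc) hc
  unfold supInB
  exact Real.iSup_le (fun x => norm_le_of_coordModel_le i b hβI T J y hc h E ν x.1 x.2) hc

/-- ★★ **ENTRY 0 — `CoRealizesRel (kernelFamilyB i B cfg O par) 0 U₁ (RelB i) (blkBK bI) (blkBK bI) evBK (GcoK …)`** for EVERY bond-sector letter `O` and EVERY `U₁`
(no domination hypothesis; only the carrier-faithfulness of `bI` on carrier blocks, n06-l `exists_carrierFaithful`): the model is the letter itself in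
κ-fold real coordinates. [cite: Balaban1985BackgroundPropagators, (3.42) p.397 (first entry) + (3.39) p.397; Balaban1984PropagatorsII, (2.51)–(2.52) p.232] -/
theorem coRealizesRel_kernelFamilyB_coords_zero
    (hβI : ∀ (x : FBondY i) (c : IBondY i), blkV1 i.hN i.D x = β i.hN i.D i.hk c → β i.hN i.D i.hk (bI x) = blkV1 i.hN i.D x) :
    CoRealizesRel (kernelFamilyB i B cfg O par) 0 U₁ (RelB i) (blkBK i bI) (blkBK i bI) (evBK i) (GcoK i b B cfg O U₁) := by
  obtain ⟨hoff, hbd⟩ := off_bound_evBK (κ := κ) i hβI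
  refine ⟨hoff, hbd, fun lam => geo9K_supNorm_nonneg i lam, ?_⟩
  intro lam y c hc hx
  cases lam with
  | inl f => exact hc
  | inr J =>
      show (⨆ E : BallY 𝔸, ((![supInB i (β i.hN i.D i.hk y) (O (cfg U₁) (liftY J (E : 𝔸))),
          ⨆ ν : Fin (d + 1), supInB i (β i.hN i.D i.hk y) (cdB i (cfg U₁) ν (O (cfg U₁) (liftY J (E : 𝔸)))),
          ⨆ ν : Fin (d + 1), supInB i (β i.hN i.D i.hk y) (O (cfg U₁) (cdsB i (cfg U₁) ν (liftY J (E : 𝔸)))),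
          supInB i (β i.hN i.D i.hk y) (lapB i (cfg U₁) (O (cfg U₁) (liftY J (E : 𝔸))))] : Fin 4 → ℝ) 0)) ≤ c
      simp only [Matrix.cons_val_zero]
      exact iSup_supInB_le_of_coordModel i b hβI ((O (cfg U₁)).restrictScalars ℝ) J y hc hx

/-- ★★ **ENTRY 1 — `CoRealizesRel … 1 U₁ (RelB i) (blkBK bI) (blkBK bI) evBK (DcoK ∘ₗ GcoK)`**: the model of `∇_U G(U)` is the composite of the models.
[cite: Balaban1985BackgroundPropagators, (3.42) p.397 (second entry); Balaban1984PropagatorsII, (2.51)–(2.52) p.232] -/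
theorem coRealizesRel_kernelFamilyB_coords_one
    (hβI : ∀ (x : FBondY i) (c : IBondY i), blkV1 i.hN i.D x = β i.hN i.D i.hk c → β i.hN i.D i.hk (bI x) = blkV1 i.hN i.D x) :
    CoRealizesRel (kernelFamilyB i B cfg O par) 1 U₁ (RelB i) (blkBK i bI) (blkBK i bI) (evBK i) (DcoK i b B cfg U₁ ∘ₗ GcoK i b B cfg O U₁) := by
  obtain ⟨hoff, hbd⟩ := off_bound_evBK (κ := κ) i hβI
  refine ⟨hoff, hbd, fun lam => geo9K_supNorm_nonneg i lam, ?_⟩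
  intro lam y c hc hx
  cases lam with
  | inl f => exact hc
  | inr J =>
      rw [DcoK_comp_GcoK] at hx
      show (⨆ E : BallY 𝔸, ((![supInB i (β i.hN i.D i.hk y) (O (cfg U₁) (liftY J (E : 𝔸))),
          ⨆ ν : Fin (d + 1), supInB i (β i.hN i.D i.hk y) (cdB i (cfg U₁) ν (O (cfg U₁) (liftY J (E : 𝔸)))),
          ⨆ ν : Fin (d + 1), supInB i (β i.hN i.D i.hk y) (O (cfg U₁) (cdsB i (cfg U₁) ν (liftY J (E : 𝔸)))),
          supInB i (β i.hN i.D i.hk y) (lapB i (cfg U₁) (O (cfg U₁) (liftY J (E : 𝔸))))] : Fin 4 → ℝ) 1)) ≤ c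
      simp only [Matrix.cons_val_one]
      exact iSup_iSup_supInB_le_of_coordModel i b hβI (fun ν => cdBₗ i (cfg U₁) ν ∘ₗ (O (cfg U₁)).restrictScalars ℝ) J y hc hx

/-- ★★ **ENTRY 2 — `CoRealizesRel … 2 U₁ (RelB i) (blkBK bI) (blkBK bI) evBK (GcoK ∘ₗ DscoK)`**: the model of `G(U)∇*_U`.
[cite: Balaban1985BackgroundPropagators, (3.42) p.397 (third entry); Balaban1984PropagatorsII, (2.51)–(2.52) p.232] -/
theorem coRealizesRel_kernelFamilyB_coords_two
    (hβI : ∀ (x : FBondY i) (c : IBondY i), blkV1 i.hN i.D x = β i.hN i.D i.hk c → β i.hN i.D i.hk (bI x) = blkV1 i.hN i.D x) :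
    CoRealizesRel (kernelFamilyB i B cfg O par) 2 U₁ (RelB i) (blkBK i bI) (blkBK i bI) (evBK i) (GcoK i b B cfg O U₁ ∘ₗ DscoK i b B cfg U₁) := by
  obtain ⟨hoff, hbd⟩ := off_bound_evBK (κ := κ) i hβI
  refine ⟨hoff, hbd, fun lam => geo9K_supNorm_nonneg i lam, ?_⟩
  intro lam y c hc hx
  cases lam with
  | inl f => exact hc
  | inr J =>
      rw [GcoK_comp_DscoK] at hx
      show (⨆ E : BallY 𝔸, ((![supInB i (β i.hN i.D i.hk y) (O (cfg U₁) (liftY J (E : 𝔸))),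
          ⨆ ν : Fin (d + 1), supInB i (β i.hN i.D i.hk y) (cdB i (cfg U₁) ν (O (cfg U₁) (liftY J (E : 𝔸)))),
          ⨆ ν : Fin (d + 1), supInB i (β i.hN i.D i.hk y) (O (cfg U₁) (cdsB i (cfg U₁) ν (liftY J (E : 𝔸)))),
          supInB i (β i.hN i.D i.hk y) (lapB i (cfg U₁) (O (cfg U₁) (liftY J (E : 𝔸))))] : Fin 4 → ℝ) 2)) ≤ c
      simp only [Matrix.cons_val_two, Matrix.tail_cons, Matrix.head_cons]
      exact iSup_iSup_supInB_le_of_coordModel i b hβI (fun ν => (O (cfg U₁)).restrictScalars ℝ ∘ₗ cdsBₗ i (cfg U₁) ν) J y hc hx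

/-- ★★ **ENTRY 3 — `CoRealizesRel … 3 U₁ (RelB i) (blkBK bI) (blkBK bI) evBK (LcoK ∘ₗ GcoK)`**: the model of `Δ_U G(U)`.
[cite: Balaban1985BackgroundPropagators, (3.42) p.397 (fourth entry); Balaban1984PropagatorsII, (2.51)–(2.52) p.232] -/
theorem coRealizesRel_kernelFamilyB_coords_three
    (hβI : ∀ (x : FBondY i) (c : IBondY i), blkV1 i.hN i.D x = β i.hN i.D i.hk c → β i.hN i.D i.hk (bI x) = blkV1 i.hN i.D x) :
    CoRealizesRel (kernelFamilyB i B cfg O par) 3 U₁ (RelB i) (blkBK i bI) (blkBK i bI) (evBK i) (LcoK i b B cfg U₁ ∘ₗ GcoK i b B cfg O U₁) := by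
  obtain ⟨hoff, hbd⟩ := off_bound_evBK (κ := κ) i hβI
  refine ⟨hoff, hbd, fun lam => geo9K_supNorm_nonneg i lam, ?_⟩
  intro lam y c hc hx
  cases lam with
  | inl f => exact hc
  | inr J =>
      rw [LcoK_comp_GcoK] at hx
      show (⨆ E : BallY 𝔸, ((![supInB i (β i.hN i.D i.hk y) (O (cfg U₁) (liftY J (E : 𝔸))),
          ⨆ ν : Fin (d + 1), supInB i (β i.hN i.D i.hk y) (cdB i (cfg U₁) ν (O (cfg U₁) (liftY J (E : 𝔸)))),
          ⨆ ν : Fin (d + 1), supInB i (β i.hN i.D i.hk y) (O (cfg U₁) (cdsB i (cfg U₁) ν (liftY J (E : 𝔸)))),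
          supInB i (β i.hN i.D i.hk y) (lapB i (cfg U₁) (O (cfg U₁) (liftY J (E : 𝔸))))] : Fin 4 → ℝ) 3)) ≤ c
      simp only [Matrix.cons_val_three, Matrix.tail_cons, Matrix.head_cons]
      have h3 := iSup_supInB_le_of_coordModel i b hβI (lapBₗ i (cfg U₁) ∘ₗ (O (cfg U₁)).restrictScalars ℝ) J y hc hx
      simpa only [LinearMap.comp_apply, lapBₗ_apply, LinearMap.coe_restrictScalars] using h3

end CoReading


end Literature.MathematicalPhysics.QuantumFieldTheory.Balaban1983to89.B9CoReadingCoords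

end
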